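import Summits.QuantumFields.GaugeBoot.PolynomialObservables
import HarnessLib

/-!
# Linear one-link shift derivatives of lattice observables and their covariance under global conjugation (gauge-boot, L1 supplement)

HONEST FRAMING (cell `pub-gaugeboot`, page 1 of every file): the venture produces certified bounds
on lattice expectations at stated coupling, gauge group, dimension and torus size; NOT a mass gap,
NOT a continuum limit, NOT a string tension; NOT Yang–Mills-summit-bearing (barriers
`FixedCouplingUltralocality`, `PerturbativeInvisibility`). Matrix calculus only; no number.

## Content

The Schwinger–Dyson rows of the lattice bootstrap differentiate an observable `S : (ι → G) → ℝ`
along the one-link left shifts `U ↦ U[e ↦ k(t) U_e]` of one-parameter families `ρ(k t) = e^{tX}`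
(`SchwingerDysonStates.IsSchwingerDysonState`). The flow-by-flow calculus of the lane
(`OneLinkShiftCalculus`, `PolynomialObservables.exists_hasDerivAt_of_mem_polyAlgebra`) produces
one derivative per family; this file records that for polynomial observables the derivative is a
LINEAR functional of the generator `X` — the cheap form of an ambient derivative — and that for
observables invariant under GLOBAL conjugation `U ↦ (g U_i g⁻¹)_i` it is conjugation-COVARIANT:

* `HasLinearShiftDeriv r e S D` — `S` is differentiable at the link `e` along every exponential
  shift with derivative `D U X`, `D U : Matrix →ₗ[ℝ] ℝ`, `U ↦ D U X` continuous;
  `HasLinearShiftDeriv.eq_of_hasDerivAt` (it is THE derivative), closure under constants, sums,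
  scalars, products (`hasLinearShiftDeriv_const`, `.add`, `.smul`, `.mul`), the generators
  `reEntryDeriv` / `imEntryDeriv` (`X ↦ Re/Im (X ρ(U_e))_{ab}`), and
  ★ `exists_hasLinearShiftDeriv_of_mem_polyAlgebra` / `_polyFunctions` — EVERY POLYNOMIAL
  OBSERVABLE HAS A LINEAR SHIFT DERIVATIVE at every link (`Algebra.adjoin_induction`);
* `conjAct g U = (g U_i g⁻¹)_i` — global conjugation (the gauge transformation by a constant gauge
  function; no lattice structure needed); `conjAct_update` — it intertwines the shift by `k` at
  `g U g⁻¹` with the shift by `g⁻¹ k g` at `U`; `rho_conj_exp` — `ρ(g⁻¹ k(t) g) = e^{t ρ(g⁻¹) X ρ(g)}`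
  (Mathlib `Matrix.exp_conj'`);
* ★ `HasLinearShiftDeriv.apply_conjAct` — COVARIANCE: for conjugation-invariant `S` and every
  generator `X` of a one-parameter family, `D (g U g⁻¹) X = D U (ρ(g⁻¹) X ρ(g))` (uniqueness of
  derivatives).

Used by `AdInvariantSchwingerDysonRows.lean` (Schwinger–Dyson rows with conjugation-invariant test
functions vanish identically on conjugation-invariant states). References: M. Creutz, *Quarks,
gluons and lattices* (1983) Ch. 11; Yu. Makeenko, *Methods of contemporary gauge theory* (2002)
Ch. 12. Folklore.
-/

noncomputable section

open Filter Topology NormedSpace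
open scoped Matrix
open Literature.MathematicalPhysics.QuantumFieldTheory (LatticeRep)

namespace Summit.QuantumFields.GaugeBoot

variable {ι : Type*} [DecidableEq ι] {G : Type*} [Group G] [TopologicalSpace G] (r : LatticeRep G)

/-! ## Linear one-link derivatives -/

section LinearDeriv

/-- **Linear one-link shift derivative.** `S : (ι → G) → ℝ` is differentiable at the link `e`
along every exponential one-link shift `U ↦ U[e ↦ k(t) U_e]`, `ρ(k t) = e^{tX}`, with derivative
`D U X` at `t = 0` given by an `ℝ`-LINEAR functional `D U` of the generator `X`, continuous in `U`
for each `X`. (Only the values of `D U` on generators matter.) [shape] A parametric definition of a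
proposition — NOT a fact. [folklore] -/
def HasLinearShiftDeriv (e : ι) (S : (ι → G) → ℝ)
    (D : (ι → G) → Matrix (Fin r.N) (Fin r.N) ℂ →ₗ[ℝ] ℝ) : Prop :=
  (∀ X, Continuous fun U => D U X) ∧
    ∀ (k : ℝ → G) (X : Matrix (Fin r.N) (Fin r.N) ℂ), (∀ t, r.ρ (k t) = exp ((t : ℂ) • X)) →
      ∀ U, HasDerivAt (fun t => S (Function.update U e (k t * U e))) (D U X) 0

variable {r} {e : ι}

omit [DecidableEq ι] in
/-- Along an exponential family `ρ(k t) = e^{tX}` of a faithful representation, `k 0 = 1`. -/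
theorem oneParam_zero {k : ℝ → G} {X : Matrix (Fin r.N) (Fin r.N) ℂ}
    (hX : ∀ t, r.ρ (k t) = exp ((t : ℂ) • X)) : k 0 = 1 := by
  apply r.injective
  rw [hX, map_one, Complex.ofReal_zero, zero_smul, exp_zero]

/-- The derivative of `HasLinearShiftDeriv` is THE derivative: any other derivative along the same
shift equals `D U X`. [folklore] -/
theorem HasLinearShiftDeriv.eq_of_hasDerivAt {S : (ι → G) → ℝ}
    {D : (ι → G) → Matrix (Fin r.N) (Fin r.N) ℂ →ₗ[ℝ] ℝ} (hD : HasLinearShiftDeriv r e S D)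
    {k : ℝ → G} {X : Matrix (Fin r.N) (Fin r.N) ℂ} (hX : ∀ t, r.ρ (k t) = exp ((t : ℂ) • X))
    {U : ι → G} {S' : ℝ} (hS' : HasDerivAt (fun t => S (Function.update U e (k t * U e))) S' 0) :
    S' = D U X :=
  hS'.unique (hD.2 k X hX U)

/-- Constants have the linear shift derivative `0`. [folklore] -/
theorem hasLinearShiftDeriv_const (c : ℝ) : HasLinearShiftDeriv r e (fun _ => c) 0 :=
  ⟨fun _ => continuous_const, fun _ _ _ _ => by simpa using hasDerivAt_const (0 : ℝ) c⟩

/-- Sums. [folklore] -/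
theorem HasLinearShiftDeriv.add {S T : (ι → G) → ℝ}
    {D E : (ι → G) → Matrix (Fin r.N) (Fin r.N) ℂ →ₗ[ℝ] ℝ} (hS : HasLinearShiftDeriv r e S D)
    (hT : HasLinearShiftDeriv r e T E) : HasLinearShiftDeriv r e (S + T) (D + E) := by
  refine ⟨fun X => (hS.1 X).add (hT.1 X), fun k X hX U => ?_⟩
  have h : HasDerivAt (fun t => S (Function.update U e (k t * U e)) +
      T (Function.update U e (k t * U e))) (D U X + E U X) 0 := (hS.2 k X hX U).add (hT.2 k X hX U)
  simpa only [Pi.add_apply, LinearMap.add_apply] using h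

/-- Leibniz rule. [folklore] -/
theorem HasLinearShiftDeriv.mul [ContinuousMul G] {S T : (ι → G) → ℝ}
    {D E : (ι → G) → Matrix (Fin r.N) (Fin r.N) ℂ →ₗ[ℝ] ℝ} (hS : HasLinearShiftDeriv r e S D)
    (hT : HasLinearShiftDeriv r e T E) (hSc : Continuous S) (hTc : Continuous T) :
    HasLinearShiftDeriv r e (S * T) (fun U => T U • D U + S U • E U) := by
  refine ⟨fun X => ?_, fun k X hX U => ?_⟩
  · simp only [LinearMap.add_apply, LinearMap.smul_apply, smul_eq_mul]
    exact (hTc.mul (hS.1 X)).add (hSc.mul (hT.1 X))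
  · have h0 : Function.update U e (k 0 * U e) = U := by
      rw [oneParam_zero hX, one_mul, Function.update_eq_self]
    have h : HasDerivAt (fun t => S (Function.update U e (k t * U e)) *
        T (Function.update U e (k t * U e)))
        (D U X * T (Function.update U e (k 0 * U e)) + S (Function.update U e (k 0 * U e)) * E U X) 0 :=
      (hS.2 k X hX U).mul (hT.2 k X hX U)
    rw [h0] at h
    refine (h.congr_deriv ?_).congr_of_eventuallyEq (Eventually.of_forall fun t => rfl)
    simp only [LinearMap.add_apply, LinearMap.smul_apply, smul_eq_mul]
    ring

/-- Scalar multiples. [folklore] -/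
theorem HasLinearShiftDeriv.smul {S : (ι → G) → ℝ}
    {D : (ι → G) → Matrix (Fin r.N) (Fin r.N) ℂ →ₗ[ℝ] ℝ} (hS : HasLinearShiftDeriv r e S D) (c : ℝ) :
    HasLinearShiftDeriv r e (c • S) (c • D) := by
  refine ⟨fun X => (hS.1 X).const_smul c, fun k X hX U => ?_⟩
  have h : HasDerivAt (fun t => c * S (Function.update U e (k t * U e))) (c * D U X) 0 :=
    (hS.2 k X hX U).const_mul c
  simpa only [Pi.smul_apply, LinearMap.smul_apply, smul_eq_mul] using h

variable (r e)

/-- The linear derivative of the generator `U ↦ Re ρ(U_{e'})_{ab}`: `X ↦ Re (X ρ(U_e))_{ab}` if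
`e' = e`, else `0`. -/
def reEntryDeriv (e' : ι) (a b : Fin r.N) (U : ι → G) : Matrix (Fin r.N) (Fin r.N) ℂ →ₗ[ℝ] ℝ :=
  if e' = e then
    Complex.reLm ∘ₗ ((Matrix.entryLinearMap ℂ ℂ a b).restrictScalars ℝ ∘ₗ
      LinearMap.mulRight ℝ (r.ρ (U e)))
  else 0

/-- The linear derivative of the generator `U ↦ Im ρ(U_{e'})_{ab}`. -/
def imEntryDeriv (e' : ι) (a b : Fin r.N) (U : ι → G) : Matrix (Fin r.N) (Fin r.N) ℂ →ₗ[ℝ] ℝ :=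
  if e' = e then
    Complex.imLm ∘ₗ ((Matrix.entryLinearMap ℂ ℂ a b).restrictScalars ℝ ∘ₗ
      LinearMap.mulRight ℝ (r.ρ (U e)))
  else 0

/-- `reEntryDeriv` evaluated. -/
theorem reEntryDeriv_apply (e' : ι) (a b : Fin r.N) (U : ι → G) (X : Matrix (Fin r.N) (Fin r.N) ℂ) :
    reEntryDeriv r e e' a b U X =
      ((if e' = e then X * r.ρ (U e) else 0 : Matrix (Fin r.N) (Fin r.N) ℂ) a b).re := by
  unfold reEntryDeriv
  split_ifs <;> simp

/-- `imEntryDeriv` evaluated. -/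
theorem imEntryDeriv_apply (e' : ι) (a b : Fin r.N) (U : ι → G) (X : Matrix (Fin r.N) (Fin r.N) ℂ) :
    imEntryDeriv r e e' a b U X =
      ((if e' = e then X * r.ρ (U e) else 0 : Matrix (Fin r.N) (Fin r.N) ℂ) a b).im := by
  unfold imEntryDeriv
  split_ifs <;> simp

/-- The generator `Re ρ(U_{e'})_{ab}` has a linear shift derivative. [folklore] -/
theorem hasLinearShiftDeriv_reEntry (e' : ι) (a b : Fin r.N) :
    HasLinearShiftDeriv r e (reEntry r e' a b) (reEntryDeriv r e e' a b) := by
  refine ⟨fun X => ?_, fun k X hX U => ?_⟩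
  · simp only [reEntryDeriv_apply]
    refine Complex.continuous_re.comp (Continuous.matrix_elem ?_ a b)
    split_ifs
    · exact continuous_const.mul (r.continuous.comp (continuous_apply e))
    · exact continuous_const
  · rw [reEntryDeriv_apply]
    exact hasDerivAt_entry_re (hasDerivAt_rho_update r.ρ hX e e' U) a b

/-- The generator `Im ρ(U_{e'})_{ab}` has a linear shift derivative. [folklore] -/
theorem hasLinearShiftDeriv_imEntry (e' : ι) (a b : Fin r.N) :
    HasLinearShiftDeriv r e (imEntry r e' a b) (imEntryDeriv r e e' a b) := by
  refine ⟨fun X => ?_, fun k X hX U => ?_⟩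
  · simp only [imEntryDeriv_apply]
    refine Complex.continuous_im.comp (Continuous.matrix_elem ?_ a b)
    split_ifs
    · exact continuous_const.mul (r.continuous.comp (continuous_apply e))
    · exact continuous_const
  · rw [imEntryDeriv_apply]
    exact hasDerivAt_entry_im (hasDerivAt_rho_update r.ρ hX e e' U) a b

/-- ★ **Every polynomial observable has a linear one-link shift derivative** at every link
(induction over the coordinate algebra: generators, constants, sums, Leibniz). [folklore] -/
theorem exists_hasLinearShiftDeriv_of_mem_polyAlgebra [ContinuousMul G] {f : C(ι → G, ℝ)}
    (hf : f ∈ polyAlgebra (ι := ι) r) :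
    ∃ D : (ι → G) → Matrix (Fin r.N) (Fin r.N) ℂ →ₗ[ℝ] ℝ, HasLinearShiftDeriv r e f D := by
  induction hf using Algebra.adjoin_induction with
  | mem f hf =>
    rcases hf with ⟨⟨e', a, b⟩, rfl⟩ | ⟨⟨e', a, b⟩, rfl⟩
    · exact ⟨_, hasLinearShiftDeriv_reEntry r e e' a b⟩
    · exact ⟨_, hasLinearShiftDeriv_imEntry r e e' a b⟩
  | algebraMap c =>
    refine ⟨0, ?_⟩
    have h : ⇑(algebraMap ℝ C(ι → G, ℝ) c) = fun _ => c := by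
      funext U
      simp [Algebra.algebraMap_eq_smul_one]
    rw [h]
    exact hasLinearShiftDeriv_const c
  | add f g _ _ ihf ihg =>
    obtain ⟨D, hD⟩ := ihf
    obtain ⟨E, hE⟩ := ihg
    exact ⟨D + E, by simpa using hD.add hE⟩
  | mul f g _ _ ihf ihg =>
    obtain ⟨D, hD⟩ := ihf
    obtain ⟨E, hE⟩ := ihg
    exact ⟨_, by simpa using hD.mul hE f.continuous g.continuous⟩

/-- Function form of `exists_hasLinearShiftDeriv_of_mem_polyAlgebra`. [folklore] -/
theorem exists_hasLinearShiftDeriv_of_mem_polyFunctions [ContinuousMul G] {f : (ι → G) → ℝ}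
    (hf : f ∈ polyFunctions (ι := ι) r) :
    ∃ D : (ι → G) → Matrix (Fin r.N) (Fin r.N) ℂ →ₗ[ℝ] ℝ, HasLinearShiftDeriv r e f D := by
  obtain ⟨g, hg, rfl⟩ := (mem_polyFunctions_iff r).1 hf
  exact exists_hasLinearShiftDeriv_of_mem_polyAlgebra r e hg

end LinearDeriv

/-! ## Global conjugation and the covariance of linear derivatives -/

section Conj

/-- **Global conjugation** of a configuration: `(conjAct g U)_i = g U_i g⁻¹` — the gauge
transformation by the CONSTANT gauge function `g`; it needs no lattice structure. [folklore] -/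
def conjAct (g : G) (U : ι → G) : ι → G := fun i => g * U i * g⁻¹

omit [DecidableEq ι] [TopologicalSpace G] in
/-- `conjAct` evaluated. -/
@[simp] theorem conjAct_apply (g : G) (U : ι → G) (i : ι) : conjAct g U i = g * U i * g⁻¹ := rfl

omit [TopologicalSpace G] in
/-- **Conjugation intertwines the one-link shifts**: shifting `g U g⁻¹` at `e` by `k` is the
conjugate of shifting `U` at `e` by `g⁻¹ k g`. [folklore] -/
theorem conjAct_update (g k : G) (U : ι → G) (e : ι) :
    conjAct g (Function.update U e (g⁻¹ * k * g * U e)) =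
      Function.update (conjAct g U) e (k * conjAct g U e) := by
  funext i
  by_cases hi : i = e
  · subst hi
    simp [mul_assoc]
  · simp [Function.update_of_ne hi]

variable {r} {e : ι}

omit [DecidableEq ι] in
/-- **The conjugate one-parameter family**: `ρ(g⁻¹ k(t) g) = e^{t ρ(g⁻¹) X ρ(g)}` when
`ρ(k t) = e^{tX}`. [folklore] -/
theorem rho_conj_exp {k : ℝ → G} {X : Matrix (Fin r.N) (Fin r.N) ℂ}
    (hX : ∀ t, r.ρ (k t) = exp ((t : ℂ) • X)) (g : G) (t : ℝ) :
    r.ρ (g⁻¹ * k t * g) = exp ((t : ℂ) • (r.ρ g⁻¹ * X * r.ρ g)) := by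
  have h1 : r.ρ g⁻¹ * r.ρ g = 1 := by rw [← map_mul, inv_mul_cancel, map_one]
  have h2 : r.ρ g * r.ρ g⁻¹ = 1 := by rw [← map_mul, mul_inv_cancel, map_one]
  -- `ρ(g)` is a unit with matrix inverse `ρ(g⁻¹)` (tree: `…Doubling.isUnit_rho`, `rho_matrix_inv`)
  have hu : IsUnit (r.ρ g) := ⟨⟨r.ρ g, r.ρ g⁻¹, h2, h1⟩, rfl⟩
  have hinv : (r.ρ g)⁻¹ = r.ρ g⁻¹ := Matrix.inv_eq_left_inv h1
  rw [map_mul, map_mul, hX, ← hinv, ← Matrix.smul_mul, ← Matrix.mul_smul, Matrix.exp_conj' _ _ hu]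

/-- ★ **Covariance of the linear derivative**: if `S` is invariant under global conjugation, its
linear shift derivative at `g U g⁻¹` in the direction `X` is its derivative at `U` in the direction
`ρ(g⁻¹) X ρ(g)` (for every generator `X` of a one-parameter family of `G`). [folklore] -/
theorem HasLinearShiftDeriv.apply_conjAct {S : (ι → G) → ℝ}
    {D : (ι → G) → Matrix (Fin r.N) (Fin r.N) ℂ →ₗ[ℝ] ℝ} (hD : HasLinearShiftDeriv r e S D)
    (hS : ∀ g U, S (conjAct g U) = S U) {k : ℝ → G} {X : Matrix (Fin r.N) (Fin r.N) ℂ}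
    (hX : ∀ t, r.ρ (k t) = exp ((t : ℂ) • X)) (g : G) (U : ι → G) :
    D (conjAct g U) X = D U (r.ρ g⁻¹ * X * r.ρ g) := by
  have h1 := hD.2 k X hX (conjAct g U)
  have h2 := hD.2 (fun t => g⁻¹ * k t * g) (r.ρ g⁻¹ * X * r.ρ g) (rho_conj_exp hX g) U
  have hfun : (fun t => S (Function.update (conjAct g U) e (k t * conjAct g U e))) =
      fun t => S (Function.update U e (g⁻¹ * k t * g * U e)) := by
    funext t
    rw [← conjAct_update, hS]
  rw [hfun] at h1
  exact h1.unique h2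

end Conj

end Summit.QuantumFields.GaugeBoot

end
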